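import Mathlib
import Literature.Uncategorized.WallMajorant

/-!
# Concave dominator of a sublinear function (one real variable)

Sub-statement (C) `ConcaveDominator` of the reduction of stub `stub_assembly` (S5 of line `Sketch`, crux
`GapDecaySuffices`; file `…StubAssembly.lean`), PROVED, with its statement written out (no definition is
introduced): every `f` with `f(s)/s → 0` is dominated in ratio by a `C^∞`, non-decreasing `ρ`, concave on
`[0, ∞)`, sublinear, unbounded, `≥ b`, of slope `≤ ε`.  Construction [folklore]: (1) a continuous monotone
sublinear majorant `F ≥ 1` of `|f|` (landed `WallMajorant`); (2) thresholds `S k ≥ 0` with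
`F(s) ≤ ε s/(k+1)³` beyond `S k` and the CONCAVE POLYGON ENVELOPE `g(s) := ⨅ₙ (ε s/(n+1) + cₙ)`,
`cₙ := (n+1) F(S n) + max b 0 + ε` — an infimum of affine functions of slopes `≤ ε`: concave, monotone,
`ε`-Lipschitz, below every piece (sublinear), `≥ (k+1) F` beyond `S k`, `≥ b` on `[-1, ∞)`; (3)
`G := max g b` and `ρ := φ ⋆ G` for a normed smooth bump `φ` of radius `1/2`: smooth
(`HasCompactSupport.contDiff_convolution_left`) and, as an average of translates `G(· − t)`, `|t| < 1/2`,
monotone, concave on `[0, ∞)`, `≥ b`, `ε`-Lipschitz (`|ρ′| ≤ ε`), within `ε/2` of `G`.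
Mathlib + `Literature.Uncategorized.WallMajorant`; no named facts, no `sorry`.
-/

noncomputable section

open Filter Set Topology MeasureTheory ContinuousLinearMap
open scoped ContDiff Convolution

namespace Summit.FinalStateConjecture.FinalStateConjecture.Theorems.GapDecaySuffices.Assembly

set_option linter.dupNamespace false

/-! ## Step 2: the concave polygon envelope `g s = ⨅ n, (ε s/(n+1) + c n)` -/

section Envelope

variable {g : ℝ → ℝ} {ε B : ℝ} {c : ℕ → ℝ}

/-- `1 ≤ n + 1` in `ℝ`. [folklore] -/
private lemma one_le_cast_succ (n : ℕ) : (1 : ℝ) ≤ n + 1 := by linarith [(n.cast_nonneg : (0 : ℝ) ≤ n)]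

/-- The family of affine pieces is bounded below (by `min B (ε s + B)`) at every point. [folklore] -/
private lemma pieces_bddBelow (hε : 0 ≤ ε) (hc : ∀ n, B ≤ c n) (s : ℝ) :
    BddBelow (range fun n : ℕ ↦ ε * s / (n + 1) + c n) := by
  refine ⟨min B (ε * s + B), ?_⟩
  rintro _ ⟨n, rfl⟩
  have hn := one_le_cast_succ n
  rcases le_or_gt 0 s with hs | hs
  · have h1 : 0 ≤ ε * s / (n + 1) := div_nonneg (mul_nonneg hε hs) (by linarith)
    exact (min_le_left _ _).trans (by linarith [hc n])
  · have h1 : ε * s ≤ ε * s / (n + 1) := by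
      rw [le_div_iff₀ (by linarith)]
      nlinarith [mul_nonpos_iff.2 (Or.inl ⟨hε, hs.le⟩)]
    exact (min_le_right _ _).trans (by linarith [hc n])

/-- The envelope lies below every piece. [folklore] -/
private lemma env_le (hg : ∀ s, g s = ⨅ n : ℕ, (ε * s / (n + 1) + c n)) (hε : 0 ≤ ε)
    (hc : ∀ n, B ≤ c n) (n : ℕ) (s : ℝ) : g s ≤ ε * s / (n + 1) + c n :=
  (hg s).trans_le (ciInf_le (pieces_bddBelow hε hc s) n)

/-- A common lower bound of the pieces bounds the envelope from below. [folklore] -/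
private lemma le_env (hg : ∀ s, g s = ⨅ n : ℕ, (ε * s / (n + 1) + c n)) {s m : ℝ}
    (h : ∀ n : ℕ, m ≤ ε * s / (n + 1) + c n) : m ≤ g s :=
  (le_ciInf h).trans_eq (hg s).symm

/-- The envelope is non-decreasing (every piece is). [folklore] -/
private lemma env_monotone (hg : ∀ s, g s = ⨅ n : ℕ, (ε * s / (n + 1) + c n)) (hε : 0 ≤ ε)
    (hc : ∀ n, B ≤ c n) : Monotone g := by
  intro s s' hss'
  refine le_env hg fun n ↦ (env_le hg hε hc n s).trans ?_
  have hn : (0 : ℝ) < n + 1 := by positivity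
  have : ε * s / (n + 1) ≤ ε * s' / (n + 1) :=
    div_le_div_of_nonneg_right (mul_le_mul_of_nonneg_left hss' hε) hn.le
  linarith

/-- The envelope has slope at most `ε`: `g s' ≤ g s + ε |s' - s|`. [folklore] -/
private lemma env_slope (hg : ∀ s, g s = ⨅ n : ℕ, (ε * s / (n + 1) + c n)) (hε : 0 ≤ ε)
    (hc : ∀ n, B ≤ c n) (s s' : ℝ) : g s' ≤ g s + ε * |s' - s| := by
  have key : ∀ n : ℕ, g s' - ε * |s' - s| ≤ ε * s / (n + 1) + c n := by
    intro n
    have h1 := env_le hg hε hc n s'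
    have hn := one_le_cast_succ n
    have h2 : ε * s' / (n + 1) - ε * s / (n + 1) ≤ ε * |s' - s| := by
      rw [← sub_div, ← mul_sub, div_le_iff₀ (by linarith)]
      nlinarith [mul_le_mul_of_nonneg_left (le_abs_self (s' - s)) hε, mul_nonneg hε (abs_nonneg (s' - s))]
    linarith
  linarith [le_env hg key]

/-- The envelope is `ε`-Lipschitz. [folklore] -/
private lemma env_lipschitz (hg : ∀ s, g s = ⨅ n : ℕ, (ε * s / (n + 1) + c n)) (hε : 0 ≤ ε)
    (hc : ∀ n, B ≤ c n) : LipschitzWith (Real.toNNReal ε) g := by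
  refine LipschitzWith.of_dist_le_mul fun s' s ↦ ?_
  rw [Real.dist_eq, Real.dist_eq, Real.coe_toNNReal _ hε, abs_sub_le_iff]
  constructor
  · linarith [env_slope hg hε hc s s']
  · have := env_slope hg hε hc s' s
    rw [abs_sub_comm] at this
    linarith

/-- The envelope is concave (an infimum of affine functions). [folklore] -/
private lemma env_concave (hg : ∀ s, g s = ⨅ n : ℕ, (ε * s / (n + 1) + c n)) (hε : 0 ≤ ε)
    (hc : ∀ n, B ≤ c n) {x y a a' : ℝ} (ha : 0 ≤ a) (ha' : 0 ≤ a') (haa : a + a' = 1) :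
    a * g x + a' * g y ≤ g (a * x + a' * y) := by
  refine le_env hg fun n ↦ ?_
  have hx := mul_le_mul_of_nonneg_left (env_le hg hε hc n x) ha
  have hy := mul_le_mul_of_nonneg_left (env_le hg hε hc n y) ha'
  have e1 : a * (ε * x / (n + 1) + c n) + a' * (ε * y / (n + 1) + c n) =
      ε * (a * x + a' * y) / (n + 1) + (a + a') * c n := by ring
  rw [haa, one_mul] at e1
  linarith

/-- The envelope is above `B - ε` on `[-1, ∞)`. [folklore] -/
private lemma env_floor (hg : ∀ s, g s = ⨅ n : ℕ, (ε * s / (n + 1) + c n)) (hε : 0 ≤ ε)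
    (hc : ∀ n, B ≤ c n) {s : ℝ} (hs : -1 ≤ s) : B - ε ≤ g s := by
  refine le_env hg fun n ↦ ?_
  have hn := one_le_cast_succ n
  have h1 : -ε ≤ ε * s / (n + 1) := by
    rw [le_div_iff₀ (by linarith)]
    nlinarith [mul_le_mul_of_nonneg_left hs hε]
  linarith [hc n]

/-- **Domination**: with thresholds `S k` beyond which `F ≤ ε s/(k+1)³` and constants
`cₙ ≥ (n+1) F(S n)`, the envelope is `≥ (k+1) F` beyond `S k`. [folklore] -/
private lemma env_dominates (hg : ∀ s, g s = ⨅ n : ℕ, (ε * s / (n + 1) + c n)) (hε : 0 ≤ ε)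
    {F : ℝ → ℝ} {S : ℕ → ℝ} (hF0 : ∀ s, 0 ≤ F s) (hFm : Monotone F) (hS0 : ∀ n, 0 ≤ S n)
    (hFS : ∀ (n : ℕ) (s : ℝ), S n ≤ s → F s ≤ ε * s / (n + 1) ^ 3)
    (hcF : ∀ n : ℕ, (n + 1) * F (S n) ≤ c n) (hc0 : ∀ n, 0 ≤ c n) (k : ℕ) {s : ℝ} (hs : S k ≤ s) :
    (k + 1) * F s ≤ g s := by
  have hs0 : 0 ≤ s := (hS0 k).trans hs
  have hk1 := one_le_cast_succ k
  refine le_env hg fun n ↦ ?_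
  have hn0 : (0 : ℝ) < n + 1 := by positivity
  have hdiv0 : 0 ≤ ε * s / (n + 1) := div_nonneg (mul_nonneg hε hs0) hn0.le
  rcases le_or_gt n k with hnk | hnk
  · -- small slopes: `ε s/(n+1) ≥ ε s/(k+1) = (k+1)² · ε s/(k+1)³ ≥ (k+1)² F s`
    have h1 : ε * s / (k + 1) ≤ ε * s / (n + 1) :=
      div_le_div_of_nonneg_left (mul_nonneg hε hs0) hn0 (by exact_mod_cast Nat.succ_le_succ hnk)
    have h2 := hFS k s hs
    have h3 : ε * s / (k + 1) = (k + 1) ^ 2 * (ε * s / (k + 1) ^ 3) := by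
      field_simp
    have h4 : (k + 1) * F s ≤ (k + 1) ^ 2 * F s :=
      mul_le_mul_of_nonneg_right (by nlinarith [hk1]) (hF0 s)
    nlinarith [hc0 n, mul_le_mul_of_nonneg_left h2 (by positivity : (0 : ℝ) ≤ (k + 1) ^ 2)]
  · have hkn : (k : ℝ) + 1 ≤ n + 1 := by exact_mod_cast Nat.succ_le_succ hnk.le
    rcases le_or_gt (S n) s with hSn | hSn
    · -- beyond `S n`: `ε s/(n+1) = (n+1)² · ε s/(n+1)³ ≥ (n+1)² F s ≥ (k+1) F s`
      have h2 := hFS n s hSn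
      have h3 : ε * s / (n + 1) = (n + 1) ^ 2 * (ε * s / (n + 1) ^ 3) := by
        field_simp
      have h4 : (k + 1) * F s ≤ (n + 1) ^ 2 * F s :=
        mul_le_mul_of_nonneg_right (by nlinarith [hk1, hkn]) (hF0 s)
      nlinarith [hc0 n, mul_le_mul_of_nonneg_left h2 (by positivity : (0 : ℝ) ≤ (n + 1) ^ 2)]
    · -- before `S n`: the constant `c n ≥ (n+1) F(S n) ≥ (k+1) F s`
      have h2 : F s ≤ F (S n) := hFm hSn.le
      nlinarith [hcF n, hF0 s]

end Envelope

/-! ## Step 3: mollification of a monotone, `ε`-Lipschitz, floored, eventually-concave function -/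

section Mollify

variable {G : ℝ → ℝ} {ε b : ℝ} (φ : ContDiffBump (0 : ℝ))

/-- The integrand `t ↦ φ(t) G(x - t)` is integrable for continuous `G`. [folklore] -/
private lemma integrable_bump_mul (hG : Continuous G) (x : ℝ) :
    Integrable (fun t ↦ φ.normed volume t * G (x - t)) :=
  (φ.continuous_normed.mul (hG.comp (continuous_const.sub continuous_id))).integrable_of_hasCompactSupport
    φ.hasCompactSupport_normed.mul_right

/-- The mollification as an explicit integral. [folklore] -/
private lemma mollify_apply (x : ℝ) :
    (φ.normed volume ⋆[lsmul ℝ ℝ, volume] G) x = ∫ t, φ.normed volume t * G (x - t) := by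
  rw [convolution_def]; rfl

/-- The mollification of a non-decreasing continuous function is non-decreasing. [folklore] -/
private lemma mollify_monotone (hG : Continuous G) (hGm : Monotone G) :
    Monotone (φ.normed volume ⋆[lsmul ℝ ℝ, volume] G) := by
  intro x y hxy
  rw [mollify_apply, mollify_apply]
  exact integral_mono (integrable_bump_mul φ hG x) (integrable_bump_mul φ hG y) fun t ↦
    mul_le_mul_of_nonneg_left (hGm (show x - t ≤ y - t by linarith)) (φ.nonneg_normed t)

/-- The mollification is above the floor of `G`. [folklore] -/
private lemma mollify_floor (hG : Continuous G) (hGb : ∀ s, b ≤ G s) (x : ℝ) :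
    b ≤ (φ.normed volume ⋆[lsmul ℝ ℝ, volume] G) x := by
  rw [mollify_apply]
  calc b = ∫ t, φ.normed volume t * b := by
        rw [integral_mul_const, φ.integral_normed, one_mul]
    _ ≤ ∫ t, φ.normed volume t * G (x - t) :=
        integral_mono ((φ.integrable_normed).mul_const b) (integrable_bump_mul φ hG x)
          fun t ↦ mul_le_mul_of_nonneg_left (hGb _) (φ.nonneg_normed t)

/-- The mollification of an `ε`-Lipschitz function is `ε`-Lipschitz. [folklore] -/
private lemma mollify_lipschitz (hG : Continuous G) (hε : 0 ≤ ε)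
    (hGl : ∀ x y, G x ≤ G y + ε * |x - y|) :
    LipschitzWith (Real.toNNReal ε) (φ.normed volume ⋆[lsmul ℝ ℝ, volume] G) := by
  have key : ∀ x y, (φ.normed volume ⋆[lsmul ℝ ℝ, volume] G) x ≤
      (φ.normed volume ⋆[lsmul ℝ ℝ, volume] G) y + ε * |x - y| := by
    intro x y
    rw [mollify_apply, mollify_apply]
    calc ∫ t, φ.normed volume t * G (x - t)
        ≤ ∫ t, (φ.normed volume t * G (y - t) + φ.normed volume t * (ε * |x - y|)) := by
          refine integral_mono (integrable_bump_mul φ hG x)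
            ((integrable_bump_mul φ hG y).add ((φ.integrable_normed).mul_const _)) fun t ↦ ?_
          have h := hGl (x - t) (y - t)
          rw [show x - t - (y - t) = x - y by ring] at h
          have := mul_le_mul_of_nonneg_left h (φ.nonneg_normed (μ := volume) t)
          linarith
      _ = (∫ t, φ.normed volume t * G (y - t)) + ε * |x - y| := by
          rw [integral_add (integrable_bump_mul φ hG y) ((φ.integrable_normed).mul_const _),
            integral_mul_const, φ.integral_normed, one_mul]
  refine LipschitzWith.of_dist_le_mul fun x y ↦ ?_
  rw [Real.dist_eq, Real.dist_eq, Real.coe_toNNReal _ hε, abs_sub_le_iff]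
  constructor
  · linarith [key x y]
  · have := key y x
    rw [abs_sub_comm] at this
    linarith

/-- The mollification is within `ε/2` of an `ε`-Lipschitz `G` (the bump has radius `1/2`). [folklore] -/
private lemma mollify_dist_le (hφ : φ.rOut ≤ 1 / 2) (hG : Continuous G) (hε : 0 ≤ ε)
    (hGl : ∀ x y, G x ≤ G y + ε * |x - y|) (x : ℝ) :
    |(φ.normed volume ⋆[lsmul ℝ ℝ, volume] G) x - G x| ≤ ε / 2 := by
  have h := φ.dist_normed_convolution_le (μ := volume) (x₀ := x) (ε := ε / 2)
    hG.aestronglyMeasurable fun y hy ↦ ?_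
  · rwa [Real.dist_eq] at h
  · rw [Metric.mem_ball, Real.dist_eq] at hy
    rw [Real.dist_eq, abs_sub_le_iff]
    have h1 := hGl y x
    have h2 := hGl x y
    rw [abs_sub_comm] at h2
    have : ε * |y - x| ≤ ε / 2 := by
      have : |y - x| ≤ 1 / 2 := hy.le.trans hφ
      nlinarith
    constructor <;> linarith

/-- The mollification of a function concave on `[-1, ∞)` is concave on `[0, ∞)`. [folklore] -/
private lemma mollify_concaveOn (hφ : φ.rOut ≤ 1 / 2) (hG : Continuous G)
    (hGc : ∀ x y a a' : ℝ, -1 ≤ x → -1 ≤ y → 0 ≤ a → 0 ≤ a' → a + a' = 1 →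
      a * G x + a' * G y ≤ G (a * x + a' * y)) :
    ConcaveOn ℝ (Set.Ici 0) (φ.normed volume ⋆[lsmul ℝ ℝ, volume] G) := by
  refine ⟨convex_Ici 0, fun x hx y hy a a' ha ha' haa ↦ ?_⟩
  simp only [smul_eq_mul]
  rw [mollify_apply, mollify_apply, mollify_apply, ← integral_const_mul, ← integral_const_mul,
    ← integral_add ((integrable_bump_mul φ hG x).const_mul a) ((integrable_bump_mul φ hG y).const_mul a')]
  refine integral_mono (((integrable_bump_mul φ hG x).const_mul a).add
    ((integrable_bump_mul φ hG y).const_mul a')) (integrable_bump_mul φ hG _) fun t ↦ ?_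
  dsimp only
  by_cases ht : φ.normed volume t = 0
  · simp [ht]
  · have ht' : t ∈ Function.support (φ.normed volume) := ht
    rw [φ.support_normed_eq, Metric.mem_ball, Real.dist_eq, sub_zero] at ht'
    have ht2 : |t| < 1 := ht'.trans_le (hφ.trans (by norm_num))
    have hxt : -1 ≤ x - t := by rw [Set.mem_Ici] at hx; linarith [(abs_lt.1 ht2).2]
    have hyt : -1 ≤ y - t := by rw [Set.mem_Ici] at hy; linarith [(abs_lt.1 ht2).2]
    have h := hGc (x - t) (y - t) a a' hxt hyt ha ha' haa
    have heq : a * (x - t) + a' * (y - t) = a * x + a' * y - t := by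
      linear_combination (-(t : ℝ)) * haa
    rw [heq] at h
    have := mul_le_mul_of_nonneg_left h (φ.nonneg_normed (μ := volume) t)
    nlinarith

/-- The mollification of a continuous function is smooth. [folklore] -/
private lemma mollify_contDiff (hG : Continuous G) :
    ContDiff ℝ ∞ (φ.normed volume ⋆[lsmul ℝ ℝ, volume] G) :=
  φ.hasCompactSupport_normed.contDiff_convolution_left _ φ.contDiff_normed
    (hG.locallyIntegrable (μ := volume))

end Mollify

/-! ## The theorem -/

/-- **Concave dominator** (sub-statement (C) of the reduction of `stub_assembly`, written out): every
`f` with `f(s)/s → 0` at `+∞` is dominated in ratio by a smooth, non-decreasing profile, concave on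
`[0, ∞)`, sublinear, unbounded, above any floor `b` and of slope at most any `ε > 0`. [folklore] -/
theorem concaveDominator (f : ℝ → ℝ) (b ε : ℝ) (hf : Tendsto (fun s ↦ f s / s) atTop (𝓝 0))
    (hε : 0 < ε) :
    ∃ ρ : ℝ → ℝ, ContDiff ℝ ∞ ρ ∧ Monotone ρ ∧ ConcaveOn ℝ (Set.Ici 0) ρ ∧
      Tendsto (fun s ↦ ρ s / s) atTop (𝓝 0) ∧ Tendsto ρ atTop atTop ∧
      (∀ s, b ≤ ρ s) ∧ (∀ s, |deriv ρ s| ≤ ε) ∧ Tendsto (fun s ↦ f s / ρ s) atTop (𝓝 0) := by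
  -- Step 1: a continuous monotone sublinear majorant `F ≥ 1` of `|f|`
  have hf' : Tendsto (fun s ↦ |f s| / s) atTop (𝓝 0) := by
    refine (abs_zero (α := ℝ) ▸ hf.abs).congr' ?_
    filter_upwards [eventually_gt_atTop 0] with s hs
    rw [abs_div, abs_of_pos hs]
  obtain ⟨T₀, F, hFc, hFm, hFsub, -, hF1, hFmaj⟩ :=
    Literature.Uncategorized.WallMajorant_holds (fun s ↦ |f s|) hf' 1 1 one_pos
  have hF0 : ∀ s, 0 ≤ F s := fun s ↦ zero_le_one.trans (hF1 s)
  have hfF : ∀ s, T₀ ≤ s → |f s| ≤ F s := fun s hs ↦ by linarith [hFmaj s hs, abs_nonneg (f s)]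
  -- Step 2: thresholds and the envelope
  have hthr : ∀ n : ℕ, ∃ S : ℝ, 0 ≤ S ∧ ∀ s, S ≤ s → F s ≤ ε * s / (n + 1) ^ 3 := by
    intro n
    have hpos : (0 : ℝ) < ε / (n + 1) ^ 3 := by positivity
    obtain ⟨S, hS⟩ := eventually_atTop.1 ((hFsub.eventually (eventually_le_nhds hpos)).and
      (eventually_gt_atTop 0))
    refine ⟨max S 0, le_max_right _ _, fun s hs ↦ ?_⟩
    obtain ⟨h1, h2⟩ := hS s ((le_max_left _ _).trans hs)
    rw [div_le_iff₀ h2] at h1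
    calc F s ≤ ε / (n + 1) ^ 3 * s := h1
      _ = ε * s / (n + 1) ^ 3 := by ring
  choose S hS0 hFS using hthr
  set B : ℝ := max b 0 + ε with hB
  set c : ℕ → ℝ := fun n ↦ (n + 1) * F (S n) + B with hc
  have hB0 : 0 ≤ B := by rw [hB]; linarith [le_max_right b 0, hε.le]
  have hcB : ∀ n, B ≤ c n := fun n ↦ by
    linarith [mul_nonneg (zero_le_one.trans (one_le_cast_succ n)) (hF0 (S n))]
  have hc0 : ∀ n, 0 ≤ c n := fun n ↦ hB0.trans (hcB n)
  have hcF : ∀ n : ℕ, (n + 1) * F (S n) ≤ c n := fun n ↦ by simp only [hc]; linarith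
  obtain ⟨g, hg⟩ : ∃ g : ℝ → ℝ, ∀ s, g s = ⨅ n : ℕ, (ε * s / (n + 1) + c n) := ⟨_, fun _ ↦ rfl⟩
  have hgm := env_monotone hg hε.le hcB
  have hgl := env_lipschitz hg hε.le hcB
  have hgc : Continuous g := hgl.continuous
  have hgdom : ∀ (k : ℕ) (s : ℝ), S k ≤ s → (k + 1) * F s ≤ g s :=
    fun k s hs ↦ env_dominates hg hε.le hF0 hFm hS0 hFS hcF hc0 k hs
  have hgfloor : ∀ s, -1 ≤ s → b ≤ g s := fun s hs ↦
    (le_max_left b 0).trans (by linarith [env_floor hg hε.le hcB hs])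
  -- Step 3: floor everywhere and mollify
  set G : ℝ → ℝ := fun s ↦ max (g s) b with hGdef
  have hGc : Continuous G := hgc.max continuous_const
  have hGm : Monotone G := fun x y h ↦ max_le_max (hgm h) le_rfl
  have hGb : ∀ s, b ≤ G s := fun s ↦ le_max_right _ _
  have hGg : ∀ s, -1 ≤ s → G s = g s := fun s hs ↦ max_eq_left (hgfloor s hs)
  have hGl : ∀ x y, G x ≤ G y + ε * |x - y| := by
    intro x y
    have h1 := env_slope hg hε.le hcB y x
    simp only [hGdef]
    exact max_le (by linarith [le_max_left (g y) b])
      (by linarith [le_max_right (g y) b, mul_nonneg hε.le (abs_nonneg (x - y))])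
  have hGconc : ∀ x y a a' : ℝ, -1 ≤ x → -1 ≤ y → 0 ≤ a → 0 ≤ a' → a + a' = 1 →
      a * G x + a' * G y ≤ G (a * x + a' * y) := by
    intro x y a a' hx hy ha ha' haa
    have hxy : -1 ≤ a * x + a' * y := by nlinarith
    rw [hGg x hx, hGg y hy, hGg _ hxy]
    exact env_concave hg hε.le hcB ha ha' haa
  obtain ⟨φ, hφ⟩ : ∃ φ : ContDiffBump (0 : ℝ), φ.rOut ≤ 1 / 2 :=
    ⟨⟨1 / 4, 1 / 2, by norm_num, by norm_num⟩, le_rfl⟩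
  set ρ : ℝ → ℝ := φ.normed volume ⋆[lsmul ℝ ℝ, volume] G with hρ
  have hρG : ∀ x, |ρ x - G x| ≤ ε / 2 := mollify_dist_le φ hφ hGc hε.le hGl
  have hρlip := mollify_lipschitz φ hGc hε.le hGl
  -- eventual comparisons `g - ε/2 ≤ ρ ≤ g + ε/2`
  have hρg : ∀ s, -1 ≤ s → g s - ε / 2 ≤ ρ s ∧ ρ s ≤ g s + ε / 2 := fun s hs ↦ by
    have h := abs_sub_le_iff.1 (hρG s)
    rw [hGg s hs] at h
    constructor <;> linarith [h.1, h.2]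
  -- `g → ∞`
  have hgtop : Tendsto g atTop atTop := by
    refine tendsto_atTop_atTop.2 fun M ↦ ?_
    obtain ⟨k, hk⟩ := exists_nat_ge M
    exact ⟨S k, fun s hs ↦ by nlinarith [hgdom k s hs, hF1 s, one_le_cast_succ k]⟩
  refine ⟨ρ, mollify_contDiff φ hGc, mollify_monotone φ hGc hGm, mollify_concaveOn φ hφ hGc hGconc, ?_,
    ?_, mollify_floor φ hGc hGb, fun s ↦ ?_, ?_⟩
  · -- sublinear: `ρ ≤ g + ε/2 ≤ ε s/(n+1) + c n + ε/2` for every `n`, and `ρ ≥ b`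
    rw [tendsto_order]
    refine ⟨fun a ha ↦ ?_, fun a ha ↦ ?_⟩
    · have h1 : Tendsto (fun s : ℝ ↦ -|b| / s) atTop (𝓝 0) := tendsto_const_nhds.div_atTop tendsto_id
      filter_upwards [h1.eventually (eventually_gt_nhds ha), eventually_gt_atTop 0] with s hs hs0
      refine hs.trans_le (div_le_div_of_nonneg_right ?_ hs0.le)
      linarith [mollify_floor φ hGc hGb s, neg_abs_le b]
    · obtain ⟨n, hn⟩ := exists_nat_gt (2 * ε / a)
      have hn1 : ε / (n + 1) < a / 2 := by
        rw [div_lt_iff₀ ha] at hn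
        rw [div_lt_iff₀ (by positivity)]
        nlinarith
      have h1 : Tendsto (fun s : ℝ ↦ (c n + ε / 2) / s) atTop (𝓝 0) :=
        tendsto_const_nhds.div_atTop tendsto_id
      filter_upwards [h1.eventually (eventually_lt_nhds (half_pos ha)), eventually_gt_atTop 0,
        eventually_ge_atTop (-1)] with s hs hs0 hs1
      have h2 := (hρg s hs1).2
      have h3 := env_le hg hε.le hcB n s
      calc ρ s / s ≤ (ε * s / (n + 1) + c n + ε / 2) / s := div_le_div_of_nonneg_right (by linarith) hs0.le
        _ = ε / (n + 1) + (c n + ε / 2) / s := by field_simp; ring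
        _ < a / 2 + a / 2 := add_lt_add hn1 hs
        _ = a := by ring
  · -- `ρ → ∞`
    refine tendsto_atTop_mono' atTop ?_ (tendsto_atTop_add_const_right _ (-(ε / 2)) hgtop)
    filter_upwards [eventually_ge_atTop (-1)] with s hs
    linarith [(hρg s hs).1]
  · -- slope
    have h := norm_deriv_le_of_lipschitz (x₀ := s) hρlip
    rwa [Real.norm_eq_abs, Real.coe_toNNReal _ hε.le] at h
  · -- ratio domination: `|f| ≤ F ≤ g/(k+1) ≤ 2ρ/(k+1)` beyond `S k`, eventually
    rw [tendsto_zero_iff_abs_tendsto_zero, tendsto_order]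
    refine ⟨fun a ha ↦ Eventually.of_forall fun s ↦ ha.trans_le (abs_nonneg _), fun a ha ↦ ?_⟩
    obtain ⟨k, hk⟩ := exists_nat_gt (2 / a)
    rw [div_lt_iff₀ ha] at hk
    filter_upwards [eventually_ge_atTop T₀, eventually_ge_atTop (-1), hgtop.eventually_ge_atTop ε,
      eventually_ge_atTop (S k)] with s hsT hs1 hsg hsS
    have hρpos : 0 < ρ s := by linarith [(hρg s hs1).1]
    show |f s / ρ s| < a
    rw [abs_div, abs_of_pos hρpos, div_lt_iff₀ hρpos]
    have h4 : (k + 1) * |f s| < (k + 1) * (a * ρ s) :=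
      calc (k + 1) * |f s| ≤ (k + 1) * F s := mul_le_mul_of_nonneg_left (hfF s hsT) (by positivity)
        _ ≤ 2 * ρ s := (hgdom k s hsS).trans (by linarith [(hρg s hs1).1])
        _ < (k + 1) * (a * ρ s) := by nlinarith
    exact lt_of_mul_lt_mul_left h4 (by positivity)

end Summit.FinalStateConjecture.FinalStateConjecture.Theorems.GapDecaySuffices.Assembly

end
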